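import Mathlib
import HarnessLib
import Summits.NavierStokesRegularity.NavierStokesRegularity.Theorems.TypeILiouvilleLambTailFading
import Summits.NavierStokesRegularity.NavierStokesRegularity.Theorems.TypeILiouvilleStrainLedgerStretchingFloor
import Summits.NavierStokesRegularity.NavierStokesRegularity.Theorems.TypeILiouvilleQuiescentGradient

/-!
# TypeILiouvilleLambTailExpDecay — crux (L) stmt-NavierStokesRegularity-10661 `TypeIliouvilleL`:
# EXPONENTIALLY ASYMPTOTICALLY BELTRAMI MEMBERS OF PRINT'S CLASS ARE ONE CONSTANT VECTOR — ANY RATE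
# (part 5 of `TypeILiouvilleLambTail`; unconditional)

Helper for stmt-NavierStokesRegularity-10661 (`--supports`); theorems only, no definitions, no named-fact
hypotheses; closes no item; Navier–Stokes regularity is NOT proved here (leafhand seat of the EulerZoomLiouville route).

Class P (`‖v‖ ≤ K` on `(−∞,0) × ℝ³`), `ω = curl v`, vortex commutator `f = Dv[ω] − Dω[v] = curl(v × ω)` as in parts 1–4.
Part 2 proved: `‖f(τ,x)‖ ≤ A e^{μτ}` with `μ > L = sup‖∇v‖` ⟹ constant (`const_of_lambTail_exp_decay`).  Here the rate
threshold is REMOVED by a bootstrap through the registered residual's own structure: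

* `const_of_commutator_exp_decay` — ★ **A class-P flow whose vortex commutator decays exponentially in the far past at
  SOME rate, `‖curl(v × ω)(τ,x)‖ ≤ A e^{μτ}` (`μ > 0` arbitrary), is ONE CONSTANT VECTOR.**  Chain (all tree theorems):
  exponential ⟹ summable Lamb tail ⟹ QUIESCENT (part 2 `quiescent_of_integrable_commutator_tail`) ⟹ the gradient
  fades, `sup_x‖∇v(τ,·)‖ → 0` (`TypeILiouvilleQuiescentGradient.fderiv_small_of_quiescent`) ⟹ below some `T < 0` the
  gradient bound is `μ/2 < μ` ⟹ the time-shifted flow `t ↦ v(t+T)` (class P, `TypeILiouvilleStrainLedger.classP_timeShift`)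
  is constant by part 2's cell ⟹ `v` is constant below `T`, hence everywhere
  (`TypeILiouvilleStrainLedger.classP_const_of_const_below`).  The statement is invariant under the Navier–Stokes
  scaling (`μ ↦ λ²μ`, `A ↦ λ⁴A`).
* `const_of_lambCurl_exp_decay` — the same with the hypothesis written on `curl (v × curl v)`.

READING for the residual of (L): the vortex commutator of a non-constant member of print's class is NOT `O(e^{μτ})`
for any `μ > 0` as `τ → −∞` — between this EMPTY exponential stratum and the generalized-Beltrami floor (`f ≡ 0`,
empty of non-constants) on one side, and the open residual L_Q on the other, only SUB-EXPONENTIALLY decaying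
(e.g. summable, or merely fading) Lamb tails remain, all of them quiescent (parts 2, 4).
HONEST LABEL: classical estimates on print's class; nothing here proves a registered stub, (L), or Navier–Stokes
regularity; rung 0.
[cite: KochNadirashviliSereginSverak2009, §4 (i), Lemma 6.1, Remark 6.1 (arXiv:0709.3599)]
[cite: MajdaBertozziCUP2002, eq. (3.80), §2.3] [cite: LemarieRieusset2016, Thm. 9.12]
-/

noncomputable section
open MeasureTheory Filter Set Function Metric
open scoped Topology ENNReal RealInnerProductSpace Laplacian ContDiff
open Literature.Analysis Literature.Analysis.FluidPDE Literature.Analysis.UnboundedOperators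
set_option linter.dupNamespace false
namespace Summit.NavierStokesRegularity.NavierStokesRegularity.Theorems.TypeILiouvilleLambTail

/-- ★ **EXPONENTIALLY ASYMPTOTICALLY BELTRAMI ⟹ ONE CONSTANT VECTOR, ANY RATE (unconditional).**  A class-P flow with
`‖Dv[ω] − Dω[v]‖(τ,x) ≤ A e^{μτ}` on `(−∞,0) × ℝ³` for some `μ > 0` is constant.  Bootstrap: summable Lamb tail ⟹
quiescent ⟹ fading gradient ⟹ gradient `≤ μ/2` below some `T` ⟹ part 2's exponential cell for the time-shifted flow
⟹ constant below `T` ⟹ constant. [cite: KochNadirashviliSereginSverak2009, §4 (i), Lemma 6.1 (arXiv:0709.3599)]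
[cite: MajdaBertozziCUP2002, eq. (3.80)] [cite: LemarieRieusset2016, Thm. 9.12] -/
theorem const_of_commutator_exp_decay
    {v : ℝ → EuclideanSpace ℝ (Fin 3) → EuclideanSpace ℝ (Fin 3)}
    (hc : ContinuousOn (uncurry v) (Iio 0 ×ˢ univ))
    (hK : ∃ K : ℝ, ∀ t < 0, ∀ x, ‖v t x‖ ≤ K)
    (hd : ∀ t < 0, IsWeaklyDivFree (v t))
    (hm : ∀ s t : ℝ, s < t → t < 0 → ∀ x,
      v t x = heatExtension (v s) (t - s) x - oseenDuhamel 1 s v v t x)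
    {μ A : ℝ} (hμ : 0 < μ)
    (hA : ∀ τ < 0, ∀ x : EuclideanSpace ℝ (Fin 3),
      ‖fderiv ℝ (v τ) x (curl (v τ) x) - fderiv ℝ (curl (v τ)) x (v τ x)‖ ≤ A * Real.exp (μ * τ)) :
    ∃ b : EuclideanSpace ℝ (Fin 3), ∀ t < 0, ∀ x, v t x = b := by
  -- summable Lamb tail ⟹ quiescent ⟹ fading gradient
  have hφc : Continuous fun τ : ℝ => A * Real.exp (μ * τ) :=
    continuous_const.mul (Real.continuous_exp.comp (continuous_const.mul continuous_id))
  have hint : IntegrableOn (fun τ : ℝ => A * Real.exp (μ * τ)) (Iic (-1)) :=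
    (integrableOn_exp_mul_Iic hμ _).const_mul A
  have hq := quiescent_of_integrable_commutator_tail hc hK hd hm hφc hA hint
  obtain ⟨T, hT0, hT⟩ :=
    TypeILiouvilleQuiescentGradient.fderiv_small_of_quiescent hc hK hd hm hq (μ / 2) (half_pos hμ)
  -- the time-shifted flow `w t = v (t + T)` is class P with gradient bound `μ/2` and commutator `≤ (A e^{μT}) e^{μt}`
  obtain ⟨hwc, hwK, hwd, hwm⟩ := TypeILiouvilleStrainLedger.classP_timeShift hc hK hd hm hT0.le
  have hwL : ∀ τ < 0, ∀ x : EuclideanSpace ℝ (Fin 3),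
      ‖fderiv ℝ ((fun t x => v (t + T) x) τ) x‖ ≤ μ / 2 := fun τ hτ x =>
    hT (τ + T) (by linarith) x
  have hwA : ∀ τ < 0, ∀ x : EuclideanSpace ℝ (Fin 3),
      ‖fderiv ℝ ((fun t x => v (t + T) x) τ) x (curl ((fun t x => v (t + T) x) τ) x) -
        fderiv ℝ (curl ((fun t x => v (t + T) x) τ)) x ((fun t x => v (t + T) x) τ x)‖ ≤
        (A * Real.exp (μ * T)) * Real.exp (μ * τ) := by
    intro τ hτ x
    have h := hA (τ + T) (by linarith) x
    have heq : A * Real.exp (μ * (τ + T)) = (A * Real.exp (μ * T)) * Real.exp (μ * τ) := by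
      rw [mul_add, Real.exp_add]; ring
    rw [heq] at h
    exact h
  obtain ⟨b, hb⟩ := const_of_lambTail_exp_decay hwc hwK hwd hwm hwL (half_lt_self hμ) hwA
  -- constant below `T`, hence everywhere
  have hb' : ∀ τ < T, ∀ x, v τ x = b := fun τ hτ x => by
    have h := hb (τ - T) (by linarith) x
    simp only [sub_add_cancel] at h
    exact h
  exact ⟨b, TypeILiouvilleStrainLedger.classP_const_of_const_below hc hK hm hb'⟩

/-- The same with the hypothesis on the CURL OF THE LAMB VECTOR: `‖curl(v × curl v)(τ,x)‖ ≤ A e^{μτ}` on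
`(−∞,0) × ℝ³` for some `μ > 0` ⟹ ONE CONSTANT VECTOR. [cite: MajdaBertozziCUP2002, §1.1, §2.3]
[cite: KochNadirashviliSereginSverak2009, §4 (i) (arXiv:0709.3599)] -/
theorem const_of_lambCurl_exp_decay
    {v : ℝ → EuclideanSpace ℝ (Fin 3) → EuclideanSpace ℝ (Fin 3)}
    (hc : ContinuousOn (uncurry v) (Iio 0 ×ˢ univ))
    (hK : ∃ K : ℝ, ∀ t < 0, ∀ x, ‖v t x‖ ≤ K)
    (hd : ∀ t < 0, IsWeaklyDivFree (v t))
    (hm : ∀ s t : ℝ, s < t → t < 0 → ∀ x,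
      v t x = heatExtension (v s) (t - s) x - oseenDuhamel 1 s v v t x)
    {μ A : ℝ} (hμ : 0 < μ)
    (hlamb : ∀ τ < 0, ∀ x : EuclideanSpace ℝ (Fin 3),
      ‖curl (fun y => cross (v τ y) (curl (v τ) y)) x‖ ≤ A * Real.exp (μ * τ)) :
    ∃ b : EuclideanSpace ℝ (Fin 3), ∀ t < 0, ∀ x, v t x = b := by
  obtain ⟨K, hKb⟩ := hK
  obtain ⟨hsm', -⟩ := smooth_and_bounds_of_bounded_ancient_oseenMild hc hd hm hKb
  have hsm : IsSmoothSpaceTimeOn (Iio 0) v := hsm'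
  have hslice : ∀ τ < 0, ContDiff ℝ 2 (v τ) := fun τ hτ =>
    (hsm.contDiff_slice (mem_Iio.2 hτ)).of_le (by norm_cast)
  have hdiv' : ∀ τ < 0, VectorCalculus.IsDivFree (v τ) := fun τ hτ =>
    (hd τ hτ).isDivFree_of_contDiff ((hslice τ hτ).of_le (by norm_num))
  refine const_of_commutator_exp_decay hc ⟨K, hKb⟩ hd hm (A := A) hμ fun τ hτ x => ?_
  rw [← TypeILiouvilleGeneralizedBeltrami.curl_lamb_eq_sub (hslice τ hτ) (hdiv' τ hτ) x]
  exact hlamb τ hτ x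

end Summit.NavierStokesRegularity.NavierStokesRegularity.Theorems.TypeILiouvilleLambTail

end
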